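import Summits.KontsevichZagierPeriods.KontsevichZagierPeriods.Theorems.HurwitzMicroSectorsNormalFormPrincipleIslandKernel
import Summits.KontsevichZagierPeriods.KontsevichZagierPeriods.Theorems.HurwitzMicroSectorsNormalFormPrinciplePiCancellationOnKernels

/-!
# `NormalFormPrinciple` (stmt-KontsevichZagierPeriods-3869), line `SketchIdeator1` —
# the product island: the second leaf (`π`-cancellation) and the pairs form

Pure proof file (lead seat c9; `--supports` the crux). On the PRODUCT ISLAND at height `q`
(`island_mem_relations_of_eval_eq_zero`, conditional on the Viola–Zudilin independence `hrig`) the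
kernel form gives at once the second leaf of the skeleton, `[π]·(…[π]·c) ∈ relations → c ∈ relations`
(`piPow_cancel_of_kernelOn`), and the leaf's own PAIRS form: two island atoms with equal values are
KZ-equivalent. References: M. Kontsevich, D. Zagier, *Periods* (2001), §1.2, §4.1; C. Viola, W. Zudilin (2018).
No definitions are introduced.
-/

noncomputable section

open MeasureTheory Set
open Literature.NumberTheory.Transcendental Literature.NumberTheory.Transcendental.KZ
open Summit.KontsevichZagierPeriods.HurwitzMicroSectors.NormalFormPrinciple.PiBox.M3 (piPow_cancel_of_kernelOn)

namespace Summit.KontsevichZagierPeriods.HurwitzMicroSectors.NormalFormPrinciple.PiBox.Island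

/-- **`stub_piCancellation` on the product island** (given `hrig`): `[π]·(…[π]·c) ∈ KZ.relations`
(`k` factors) forces `c ∈ KZ.relations` for `c` in the island subgroup. [cite: KontsevichZagier2001, §4.1] -/
theorem island_piPow_cancel (q : ℕ) (hq : 2 ≤ q)
    (hrig : ∀ a b c d : ℚ,
      (a:ℝ) + b * (∫ t in Set.Ioo (0:ℝ) 1, 1 / ((q:ℝ) - t)) +
        c * (∫ x in {x : Fin 2 → ℝ | ∀ i, x i ∈ Set.Ioo (0:ℝ) 1}, 1 / ((q:ℝ) - x 0 * x 1)) +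
        d * (∫ t in Set.Ioo (0:ℝ) 1, 1 / ((q:ℝ) - t)) ^ 2 = 0 → a = 0 ∧ b = 0 ∧ c = 0 ∧ d = 0)
    (k : ℕ) {c : FormalRep}
    (hc : c ∈ AddSubgroup.closure
      ({y : FormalRep | ∃ N : IntegralRep 2, N.domain = {x | ∀ i, x i ∈ Set.Ioo (0:ℝ) 1} ∧
          EqOn N.integrand (fun _ => (1:ℝ)) N.domain ∧ y = of N} ∪
       {y : FormalRep | ∃ N : IntegralRep 2, N.domain = {x | ∀ i, x i ∈ Set.Ioo (0:ℝ) 1} ∧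
          EqOn N.integrand (fun x => 1 / ((q:ℝ) - x 0)) N.domain ∧ y = of N} ∪
       {y : FormalRep | ∃ N : IntegralRep 2, N.domain = {x | ∀ i, x i ∈ Set.Ioo (0:ℝ) 1} ∧
          EqOn N.integrand (fun x => 1 / ((q:ℝ) - x 1)) N.domain ∧ y = of N} ∪
       {y : FormalRep | ∃ N : IntegralRep 2, N.domain = {x | ∀ i, x i ∈ Set.Ioo (0:ℝ) 1} ∧
          EqOn N.integrand (fun x => 1 / ((q:ℝ) - x 0 * x 1)) N.domain ∧ y = of N} ∪
       {y : FormalRep | ∃ N : IntegralRep 2, N.domain = {x | ∀ i, x i ∈ Set.Ioo (0:ℝ) 1} ∧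
          EqOn N.integrand (fun x => 1 / (((q:ℝ) - x 0) * ((q:ℝ) - x 1))) N.domain ∧ y = of N} ∪
       {y : FormalRep | ∃ N : IntegralRep 2, N.domain = {x | ∀ i, x i ∈ Set.Ioo (0:ℝ) 1} ∧
          EqOn N.integrand (fun x => 1 / (((q:ℝ) - x 0) * ((q:ℝ) - x 0 * x 1))) N.domain ∧ y = of N} ∪
       {y : FormalRep | ∃ N : IntegralRep 2, N.domain = {x | ∀ i, x i ∈ Set.Ioo (0:ℝ) 1} ∧
          EqOn N.integrand (fun x => 1 / (((q:ℝ) - x 1) * ((q:ℝ) - x 0 * x 1))) N.domain ∧ y = of N} ∪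
       {y : FormalRep | ∃ N : IntegralRep 2, N.domain = {x | ∀ i, x i ∈ Set.Ioo (0:ℝ) 1} ∧
          EqOn N.integrand (fun x => 1 / (((q:ℝ) - x 0) * ((q:ℝ) - x 1) * ((q:ℝ) - x 0 * x 1))) N.domain ∧ y = of N}))
    (h : (fun x => of piRep * x)^[k] c ∈ relations) : c ∈ relations :=
  piPow_cancel_of_kernelOn (fun _ hc hv => island_mem_relations_of_eval_eq_zero q hq hrig hc hv) k hc h

/-- **The leaf's pairs form on the product island** (given `hrig`): two island atoms with equal
values are KZ-equivalent. [cite: KontsevichZagier2001, §1.2 Conjecture 1] -/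
theorem island_equivalent_of_value_eq (q : ℕ) (hq : 2 ≤ q)
    (hrig : ∀ a b c d : ℚ,
      (a:ℝ) + b * (∫ t in Set.Ioo (0:ℝ) 1, 1 / ((q:ℝ) - t)) +
        c * (∫ x in {x : Fin 2 → ℝ | ∀ i, x i ∈ Set.Ioo (0:ℝ) 1}, 1 / ((q:ℝ) - x 0 * x 1)) +
        d * (∫ t in Set.Ioo (0:ℝ) 1, 1 / ((q:ℝ) - t)) ^ 2 = 0 → a = 0 ∧ b = 0 ∧ c = 0 ∧ d = 0)
    (N N' : IntegralRep 2)
    (hN : of N ∈ ({y : FormalRep | ∃ N : IntegralRep 2, N.domain = {x | ∀ i, x i ∈ Set.Ioo (0:ℝ) 1} ∧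
          EqOn N.integrand (fun _ => (1:ℝ)) N.domain ∧ y = of N} ∪
       {y : FormalRep | ∃ N : IntegralRep 2, N.domain = {x | ∀ i, x i ∈ Set.Ioo (0:ℝ) 1} ∧
          EqOn N.integrand (fun x => 1 / ((q:ℝ) - x 0)) N.domain ∧ y = of N} ∪
       {y : FormalRep | ∃ N : IntegralRep 2, N.domain = {x | ∀ i, x i ∈ Set.Ioo (0:ℝ) 1} ∧
          EqOn N.integrand (fun x => 1 / ((q:ℝ) - x 1)) N.domain ∧ y = of N} ∪
       {y : FormalRep | ∃ N : IntegralRep 2, N.domain = {x | ∀ i, x i ∈ Set.Ioo (0:ℝ) 1} ∧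
          EqOn N.integrand (fun x => 1 / ((q:ℝ) - x 0 * x 1)) N.domain ∧ y = of N} ∪
       {y : FormalRep | ∃ N : IntegralRep 2, N.domain = {x | ∀ i, x i ∈ Set.Ioo (0:ℝ) 1} ∧
          EqOn N.integrand (fun x => 1 / (((q:ℝ) - x 0) * ((q:ℝ) - x 1))) N.domain ∧ y = of N} ∪
       {y : FormalRep | ∃ N : IntegralRep 2, N.domain = {x | ∀ i, x i ∈ Set.Ioo (0:ℝ) 1} ∧
          EqOn N.integrand (fun x => 1 / (((q:ℝ) - x 0) * ((q:ℝ) - x 0 * x 1))) N.domain ∧ y = of N} ∪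
       {y : FormalRep | ∃ N : IntegralRep 2, N.domain = {x | ∀ i, x i ∈ Set.Ioo (0:ℝ) 1} ∧
          EqOn N.integrand (fun x => 1 / (((q:ℝ) - x 1) * ((q:ℝ) - x 0 * x 1))) N.domain ∧ y = of N} ∪
       {y : FormalRep | ∃ N : IntegralRep 2, N.domain = {x | ∀ i, x i ∈ Set.Ioo (0:ℝ) 1} ∧
          EqOn N.integrand (fun x => 1 / (((q:ℝ) - x 0) * ((q:ℝ) - x 1) * ((q:ℝ) - x 0 * x 1))) N.domain ∧ y = of N}))
    (hN' : of N' ∈ ({y : FormalRep | ∃ N : IntegralRep 2, N.domain = {x | ∀ i, x i ∈ Set.Ioo (0:ℝ) 1} ∧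
          EqOn N.integrand (fun _ => (1:ℝ)) N.domain ∧ y = of N} ∪
       {y : FormalRep | ∃ N : IntegralRep 2, N.domain = {x | ∀ i, x i ∈ Set.Ioo (0:ℝ) 1} ∧
          EqOn N.integrand (fun x => 1 / ((q:ℝ) - x 0)) N.domain ∧ y = of N} ∪
       {y : FormalRep | ∃ N : IntegralRep 2, N.domain = {x | ∀ i, x i ∈ Set.Ioo (0:ℝ) 1} ∧
          EqOn N.integrand (fun x => 1 / ((q:ℝ) - x 1)) N.domain ∧ y = of N} ∪
       {y : FormalRep | ∃ N : IntegralRep 2, N.domain = {x | ∀ i, x i ∈ Set.Ioo (0:ℝ) 1} ∧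
          EqOn N.integrand (fun x => 1 / ((q:ℝ) - x 0 * x 1)) N.domain ∧ y = of N} ∪
       {y : FormalRep | ∃ N : IntegralRep 2, N.domain = {x | ∀ i, x i ∈ Set.Ioo (0:ℝ) 1} ∧
          EqOn N.integrand (fun x => 1 / (((q:ℝ) - x 0) * ((q:ℝ) - x 1))) N.domain ∧ y = of N} ∪
       {y : FormalRep | ∃ N : IntegralRep 2, N.domain = {x | ∀ i, x i ∈ Set.Ioo (0:ℝ) 1} ∧
          EqOn N.integrand (fun x => 1 / (((q:ℝ) - x 0) * ((q:ℝ) - x 0 * x 1))) N.domain ∧ y = of N} ∪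
       {y : FormalRep | ∃ N : IntegralRep 2, N.domain = {x | ∀ i, x i ∈ Set.Ioo (0:ℝ) 1} ∧
          EqOn N.integrand (fun x => 1 / (((q:ℝ) - x 1) * ((q:ℝ) - x 0 * x 1))) N.domain ∧ y = of N} ∪
       {y : FormalRep | ∃ N : IntegralRep 2, N.domain = {x | ∀ i, x i ∈ Set.Ioo (0:ℝ) 1} ∧
          EqOn N.integrand (fun x => 1 / (((q:ℝ) - x 0) * ((q:ℝ) - x 1) * ((q:ℝ) - x 0 * x 1))) N.domain ∧ y = of N}))
    (hval : N.value = N'.value) : Equivalent N N' := by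
  refine island_mem_relations_of_eval_eq_zero q hq hrig (AddSubgroup.sub_mem _
    (AddSubgroup.subset_closure hN) (AddSubgroup.subset_closure hN')) ?_
  rw [map_sub, eval_of, eval_of, hval, sub_self]

end Summit.KontsevichZagierPeriods.HurwitzMicroSectors.NormalFormPrinciple.PiBox.Island
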